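import Literature.Barriers.QuantumFields.FiniteTemperatureSpatialReflection
import HarnessLib

/-!
# Spatial reflections, even spatial period: the two halves, blocks of links, dependence lemmas

Second of three theorem-only files on spatial reflection positivity for the finite-temperature
Wilson lattice gauge theory (see `FiniteTemperatureSpatialReflection`). For an even spatial period
`L = 2n + 2` and a spatial direction `i`:

* `bondPosExp` — the part `A(U)` of `−S` lying in the half `A = {x_i ∈ {0, −1, …, −n}}` for the BOND
  reflection `θ : x_i ↦ 1 − x_i` (which exchanges `A` and `B = {1, …, n+1}`), and
  `minusAction_eq_bondPosExp : −S(U) = A(U) + A(θU) + crossSlice_0(U) + crossSlice_{n+1}(U)`;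
* `sitePosExp` — the part `A'(U)` for the SITE reflection `σ : x_i ↦ −x_i` (planes `x_i = 0`,
  `x_i = n + 1` shared), and `minusAction_eq_sitePosExp : −S = A'(U) + A'(σU) + inSlice_0 + inSlice_{n+1}`;
* the blocks of links `bondCross` (direction-`i` links across the two bonds), `bondPos`,
  `siteShared`, `sitePos`, with membership lemmas and `disjoint_siteShared_sitePos`;
* congruence lemmas `inSlice_congr`, `crossSlice_congr` and the DEPENDENCE facts consumed by the
  abstract reflection-positivity theorems of `LatticeRPMechanism` / `LatticeSiteRPMechanism`:
  `dependsOn_bondPosExp(')`, `dependsOn_spaceReflect_apply` (the `P ∪ C`-coordinates of `θU`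
  depend on `U` off `P`), `dependsOn_sitePosExp`, `dependsOn_inSlice_plane`,
  `spaceSiteReflect_apply_of_mem_siteShared` (`σ` fixes the shared block),
  `inSlice_plane_spaceSiteReflect`, `dependsOn_spaceSiteReflect_apply` (needs `n ≥ 1`, i.e.
  `L ≥ 4`).

References: C. Borgs, E. Seiler, Commun. Math. Phys. 91 (1983) 329–380, §II.2 (pp. 331–332);
J. Fröhlich, R. Israel, E. H. Lieb, B. Simon, Commun. Math. Phys. 62 (1978) 1, Thm 2.1.
[BorgsSeiler1983] [FrohlichEtAl1978]
-/

noncomputable section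

open MeasureTheory Filter Topology
open scoped ComplexConjugate ComplexOrder

namespace Literature.Barriers.QuantumFields

namespace FiniteTemperature

/-! ### Even spatial period `L = 2n + 2`: the two halves and the decomposition of the action -/

section EvenDecomp

variable {d L₀ n : ℕ} {G : Type*} [Group G] {N : ℕ}
variable (ρ : G →* Matrix (Fin N) (Fin N) ℂ)

/-- **The positive-side exponent for the bond reflection**: in-slice terms of the slices
`0, −1, …, −n` and cross terms of the bonds `(−1, 0), …, (−n, −n+1)` (the half
`A = {0, −1, …, −n}` of `ℤ_{2n+2}`, interchanged with `B = {1, …, n+1}` by `x_i ↦ 1 − x_i`). [folklore] -/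
def bondPosExp [NeZero L₀] (JE JM : ℝ) (i : Fin d) (U : Config d L₀ (2 * n + 2) G) : ℝ :=
  inSlice ρ JE JM i 0 U + ∑ k ∈ Finset.range n,
    (inSlice ρ JE JM i (-((k + 1 : ℕ) : ZMod (2 * n + 2))) U +
      crossSlice ρ JE JM i (-((k + 1 : ℕ) : ZMod (2 * n + 2))) U)

/-- **Decomposition of the action for the bond reflection** (unitary `ρ`):
`−S(U) = A(U) + A(θU) + crossSlice_0(U) + crossSlice_{n+1}(U)`. [folklore] -/
theorem minusAction_eq_bondPosExp [NeZero L₀] (hρu : ∀ g, ρ g ∈ Matrix.unitaryGroup (Fin N) ℂ)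
    (JE JM : ℝ) (i : Fin d) (U : Config d L₀ (2 * n + 2) G) :
    minusAction ρ JE JM U = bondPosExp ρ JE JM i U + bondPosExp ρ JE JM i (spaceReflect i U) +
      crossSlice ρ JE JM i 0 U + crossSlice ρ JE JM i ((n + 1 : ℕ) : ZMod (2 * n + 2)) U := by
  rw [minusAction_eq_sum_dirSlices ρ JE JM i U, sum_zmod_even_split_neg]
  unfold bondPosExp
  simp only [inSlice_spaceReflect, crossSlice_spaceReflect ρ hρu, sub_zero, sub_neg_eq_add, neg_neg,
    Finset.sum_add_distrib]
  -- the in-slice terms on the `B` side: `Σ_{k<n} in_{k+2} + in_1 = in_{n+1} + Σ_{k<n} in_{k+1}`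
  have hB : ∑ k ∈ Finset.range n, inSlice ρ JE JM i (1 + ((k + 1 : ℕ) : ZMod (2 * n + 2))) U +
      inSlice ρ JE JM i 1 U =
      inSlice ρ JE JM i ((n + 1 : ℕ) : ZMod (2 * n + 2)) U +
        ∑ k ∈ Finset.range n, inSlice ρ JE JM i ((k + 1 : ℕ) : ZMod (2 * n + 2)) U := by
    have h1 := Finset.sum_range_succ' (fun k => inSlice ρ JE JM i ((k + 1 : ℕ) : ZMod (2 * n + 2)) U) n
    have h2 := Finset.sum_range_succ (fun k => inSlice ρ JE JM i ((k + 1 : ℕ) : ZMod (2 * n + 2)) U) n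
    simp only [Nat.cast_add, Nat.cast_one] at h1 h2 ⊢
    have h3 : ∀ k : ℕ, (1 + ((k : ZMod (2 * n + 2)) + 1)) = ((k : ZMod (2 * n + 2)) + 1 + 1) := fun k => by ring
    simp only [h3, Nat.cast_zero, zero_add] at h1 ⊢
    rw [← h1, h2, add_comm]
  push_cast at hB ⊢
  linarith [hB]

end EvenDecomp

section SiteDecomp

variable {d L₀ n : ℕ} {G : Type*} [Group G] {N : ℕ}
variable (ρ : G →* Matrix (Fin N) (Fin N) ℂ)

/-- **The positive-side exponent for the site reflection** (half `A' = {0, −1, …, −(n+1)}` with the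
planes `0`, `−(n+1) = n+1` shared): in-slice terms of the slices `−1, …, −n` and cross terms of the
bonds `(−1,0), …, (−(n+1), −n)`. [folklore] -/
def sitePosExp [NeZero L₀] (JE JM : ℝ) (i : Fin d) (U : Config d L₀ (2 * n + 2) G) : ℝ :=
  ∑ k ∈ Finset.range n, inSlice ρ JE JM i (-((k + 1 : ℕ) : ZMod (2 * n + 2))) U +
    ∑ k ∈ Finset.range (n + 1), crossSlice ρ JE JM i (-((k + 1 : ℕ) : ZMod (2 * n + 2))) U

/-- **Decomposition of the action for the site reflection** (unitary `ρ`):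
`−S(U) = A'(U) + A'(σU) + inSlice_0(U) + inSlice_{n+1}(U)` — the two halves interact only through
the plaquettes lying in the two reflection hyperplanes. [folklore] -/
theorem minusAction_eq_sitePosExp [NeZero L₀] (hρu : ∀ g, ρ g ∈ Matrix.unitaryGroup (Fin N) ℂ)
    (JE JM : ℝ) (i : Fin d) (U : Config d L₀ (2 * n + 2) G) :
    minusAction ρ JE JM U = sitePosExp ρ JE JM i U + sitePosExp ρ JE JM i (spaceSiteReflect i U) +
      inSlice ρ JE JM i 0 U + inSlice ρ JE JM i ((n + 1 : ℕ) : ZMod (2 * n + 2)) U := by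
  rw [minusAction_eq_sum_dirSlices ρ JE JM i U, Finset.sum_add_distrib, sum_zmod_even_split_neg,
    sum_zmod_even_split_elec]
  unfold sitePosExp
  simp only [inSlice_spaceSiteReflect, crossSlice_spaceSiteReflect ρ hρu, neg_neg, sub_neg_eq_add,
    Finset.sum_add_distrib]
  have h1 : ∀ k : ℕ, (-1 + ((k + 1 : ℕ) : ZMod (2 * n + 2))) = (k : ZMod (2 * n + 2)) := fun k => by
    push_cast; ring
  have h2 : ∀ k : ℕ, (-1 - (k : ZMod (2 * n + 2))) = -((k + 1 : ℕ) : ZMod (2 * n + 2)) := fun k => by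
    push_cast; ring
  simp only [h1, h2]
  ring

end SiteDecomp

/-! ### Blocks of links for the two reflections (even period) and dependence lemmas -/

section Blocks

variable {d L₀ n : ℕ} [NeZero L₀] {G : Type*} [Group G] {N : ℕ}

/-- Every residue is minus its "negative representative": `x = −((−x).val)`. [folklore] -/
theorem eq_neg_natCast_val_neg (x : ZMod (2 * n + 2)) : x = -((((-x).val : ℕ)) : ZMod (2 * n + 2)) := by
  rw [ZMod.natCast_zmod_val, neg_neg]

/-- `(−m).val = 2n + 2 − m` for `1 ≤ m ≤ 2n + 1`. [folklore] -/
theorem val_neg_natCast {m : ℕ} (h1 : 1 ≤ m) (h2 : m ≤ 2 * n + 1) :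
    (-((m : ℕ) : ZMod (2 * n + 2))).val = 2 * n + 2 - m := by
  rw [ZMod.neg_val, ZMod.val_cast_of_lt (by omega)]
  have : ((m : ℕ) : ZMod (2 * n + 2)) ≠ 0 := by
    intro h
    have := congrArg ZMod.val h
    rw [ZMod.val_cast_of_lt (by omega), ZMod.val_zero] at this
    omega
  rw [if_neg this]

/-- `(m : ℤ_{2n+2}).val = m` for `m ≤ 2n + 1`. [folklore] -/
theorem val_natCast_of_le {m : ℕ} (h : m ≤ 2 * n + 1) : ((m : ℕ) : ZMod (2 * n + 2)).val = m :=
  ZMod.val_cast_of_lt (by omega)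

variable (d L₀ n) in
/-- **Crossing block of the bond reflection**: the direction-`i` links across the bonds `(0,1)` and
`(n+1, n+2)`. [folklore] -/
def bondCross (i : Fin d) : Finset (Site d L₀ (2 * n + 2) × Dir d) :=
  Finset.univ.filter fun e => e.2 = some i ∧ (e.1.2 i = 0 ∨ e.1.2 i = ((n + 1 : ℕ) : ZMod (2 * n + 2)))

variable (d L₀ n) in
/-- **Positive block of the bond reflection**: all links based in the half `A = {0, −1, …, −n}`
except the crossing ones. [folklore] -/
def bondPos (i : Fin d) : Finset (Site d L₀ (2 * n + 2) × Dir d) :=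
  Finset.univ.filter fun e => (-e.1.2 i).val ≤ n ∧
    ¬(e.2 = some i ∧ (e.1.2 i = 0 ∨ e.1.2 i = ((n + 1 : ℕ) : ZMod (2 * n + 2))))

variable (d L₀ n) in
/-- **Shared block of the site reflection**: the non-`i` links in the hyperplanes `x_i = 0` and
`x_i = n + 1`. [folklore] -/
def siteShared (i : Fin d) : Finset (Site d L₀ (2 * n + 2) × Dir d) :=
  Finset.univ.filter fun e => e.2 ≠ some i ∧ (e.1.2 i = 0 ∨ e.1.2 i = ((n + 1 : ℕ) : ZMod (2 * n + 2)))

variable (d L₀ n) in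
/-- **Positive block of the site reflection**: all links based at the slices `−1, …, −n`, and the
direction-`i` links from the slice `n + 1` (to the slice `n + 2 = −n`). [folklore] -/
def sitePos (i : Fin d) : Finset (Site d L₀ (2 * n + 2) × Dir d) :=
  Finset.univ.filter fun e => (1 ≤ (-e.1.2 i).val ∧ (-e.1.2 i).val ≤ n) ∨
    (e.2 = some i ∧ e.1.2 i = ((n + 1 : ℕ) : ZMod (2 * n + 2)))

/-- Membership in the crossing block. [folklore] -/
@[simp] theorem mem_bondCross {i : Fin d} {e : Site d L₀ (2 * n + 2) × Dir d} :
    e ∈ bondCross d L₀ n i ↔ e.2 = some i ∧ (e.1.2 i = 0 ∨ e.1.2 i = ((n + 1 : ℕ) : ZMod (2 * n + 2))) := by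
  simp [bondCross]

/-- Membership in the positive block of the bond reflection. [folklore] -/
@[simp] theorem mem_bondPos {i : Fin d} {e : Site d L₀ (2 * n + 2) × Dir d} :
    e ∈ bondPos d L₀ n i ↔ (-e.1.2 i).val ≤ n ∧
      ¬(e.2 = some i ∧ (e.1.2 i = 0 ∨ e.1.2 i = ((n + 1 : ℕ) : ZMod (2 * n + 2)))) := by
  simp [bondPos]

/-- Membership in the shared block. [folklore] -/
@[simp] theorem mem_siteShared {i : Fin d} {e : Site d L₀ (2 * n + 2) × Dir d} :
    e ∈ siteShared d L₀ n i ↔ e.2 ≠ some i ∧ (e.1.2 i = 0 ∨ e.1.2 i = ((n + 1 : ℕ) : ZMod (2 * n + 2))) := by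
  simp [siteShared]

/-- Membership in the positive block of the site reflection. [folklore] -/
@[simp] theorem mem_sitePos {i : Fin d} {e : Site d L₀ (2 * n + 2) × Dir d} :
    e ∈ sitePos d L₀ n i ↔ (1 ≤ (-e.1.2 i).val ∧ (-e.1.2 i).val ≤ n) ∨
      (e.2 = some i ∧ e.1.2 i = ((n + 1 : ℕ) : ZMod (2 * n + 2))) := by
  simp [sitePos]

/-- The shared block of the site reflection is disjoint from its positive block. [folklore] -/
theorem disjoint_siteShared_sitePos (i : Fin d) : Disjoint (siteShared d L₀ n i) (sitePos d L₀ n i) := by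
  rw [Finset.disjoint_left]
  intro e h1 h2
  rw [mem_siteShared] at h1
  rw [mem_sitePos] at h2
  rcases h2 with ⟨h21, h22⟩ | ⟨h, -⟩
  · rcases h1.2 with h | h
    · rw [h, neg_zero, ZMod.val_zero] at h21; omega
    · rw [h, neg_half, val_natCast_half] at h22; omega
  · exact h1.1 h

/-! #### Congruence lemmas for the slice sums -/

variable (ρ : G →* Matrix (Fin N) (Fin N) ℂ)

omit ρ in
omit [NeZero L₀] ρ in
/-- Shifts in directions other than `i` stay in the slice. [folklore] -/
theorem shift_apply_dir_of_ne {L : ℕ} (y : Site d L₀ L) {μ : Dir d} (i : Fin d) (hμ : μ ≠ some i) :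
    (y.shift μ).2 i = y.2 i := by
  rcases μ with _ | k
  · rfl
  · have hk : k ≠ i := fun h => hμ (by rw [h])
    simp [Site.shift, hk.symm]

/-- Two configurations agreeing on the non-`i` links based in the slice `j` have the same in-slice
sum at `j`. [folklore] -/
theorem inSlice_congr {L : ℕ} [NeZero L] (JE JM : ℝ) (i : Fin d) (j : ZMod L)
    {U V : Config d L₀ L G}
    (h : ∀ (s : Site d L₀ L) (μ : Dir d), s.2 i = j → μ ≠ some i → U (s, μ) = V (s, μ)) :
    inSlice ρ JE JM i j U = inSlice ρ JE JM i j V := by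
  unfold inSlice
  refine Finset.sum_congr rfl fun y _ => ?_
  by_cases hy : y.2 i = j
  · rw [if_pos hy, if_pos hy]
    have hpl : ∀ μ ν : Dir d, μ ≠ some i → ν ≠ some i → plaquette U y μ ν = plaquette V y μ ν := by
      intro μ ν hμ hν
      unfold plaquette
      rw [h y μ hy hμ, h _ ν (by rw [shift_apply_dir_of_ne y i hμ, hy]) hν,
        h _ μ (by rw [shift_apply_dir_of_ne y i hν, hy]) hμ, h y ν hy hν]
    congr 2
    · refine Finset.sum_congr rfl fun k hk => ?_
      have hk' : k ≠ i := (Finset.mem_filter.1 hk).2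
      rw [hpl none (some k) (by simp) (by simpa using hk')]
    · refine Finset.sum_congr rfl fun p hp => ?_
      have hp' := (Finset.mem_filter.1 hp).2
      rw [hpl _ _ (by simpa using hp'.1) (by simpa using hp'.2)]
  · rw [if_neg hy, if_neg hy]

/-- Two configurations agreeing on the direction-`i` links of the slice `j` and on the non-`i` links
of the slices `j` and `j + 1` have the same cross-slice sum at `j`. [folklore] -/
theorem crossSlice_congr {L : ℕ} [NeZero L] (JE JM : ℝ) (i : Fin d) (j : ZMod L)
    {U V : Config d L₀ L G}
    (hi : ∀ s : Site d L₀ L, s.2 i = j → U (s, some i) = V (s, some i))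
    (h : ∀ (s : Site d L₀ L) (μ : Dir d), (s.2 i = j ∨ s.2 i = j + 1) → μ ≠ some i → U (s, μ) = V (s, μ)) :
    crossSlice ρ JE JM i j U = crossSlice ρ JE JM i j V := by
  unfold crossSlice
  refine Finset.sum_congr rfl fun y _ => ?_
  by_cases hy : y.2 i = j
  · rw [if_pos hy, if_pos hy]
    have hyi : (y.shift (some i)).2 i = j + 1 := by simp [Site.shift, hy]
    congr 2
    · unfold plaquette
      rw [h y none (Or.inl hy) (by simp), hi _ (by rw [shift_apply_dir_of_ne y i (by simp), hy]),
        h _ none (Or.inr hyi) (by simp), hi y hy]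
    · refine Finset.sum_congr rfl fun p hp => ?_
      have hp' := (Finset.mem_filter.1 hp).2
      by_cases h1 : p.1.1 = i
      · have h2 : p.1.2 ≠ i := by
          intro h2; have := p.2; rw [h1, h2] at this; exact lt_irrefl _ this
        simp only [h1]
        unfold plaquette
        rw [hi y hy, h _ _ (Or.inr hyi) (by simpa using h2),
          hi _ (by rw [shift_apply_dir_of_ne y i (by simpa using h2), hy]), h y _ (Or.inl hy) (by simpa using h2)]
      · have h2 : p.1.2 = i := by by_contra h2; exact hp' ⟨h1, h2⟩
        simp only [h2]
        unfold plaquette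
        rw [h y _ (Or.inl hy) (by simpa using h1), hi _ (by rw [shift_apply_dir_of_ne y i (by simpa using h1), hy]),
          h _ _ (Or.inr hyi) (by simpa using h1), hi y hy]
  · rw [if_neg hy, if_neg hy]

end Blocks

section Depends

variable {d L₀ n : ℕ} [NeZero L₀] {G : Type*} [Group G] {N : ℕ}
variable (ρ : G →* Matrix (Fin N) (Fin N) ℂ)

/-- `−(k+1) ≠ 0` in `ℤ_{2n+2}` for `k ≤ n`. [folklore] -/
theorem neg_natCast_succ_ne_zero {k : ℕ} (hk : k ≤ n) : (-((k + 1 : ℕ) : ZMod (2 * n + 2))) ≠ 0 := by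
  intro h
  have := congrArg ZMod.val h
  rw [val_neg_natCast (by omega) (by omega), ZMod.val_zero] at this
  omega

/-- `−(k+1) ≠ n+1` in `ℤ_{2n+2}` for `k < n`. [folklore] -/
theorem neg_natCast_succ_ne_half {k : ℕ} (hk : k < n) :
    (-((k + 1 : ℕ) : ZMod (2 * n + 2))) ≠ ((n + 1 : ℕ) : ZMod (2 * n + 2)) := by
  intro h
  have := congrArg ZMod.val h
  rw [val_neg_natCast (by omega) (by omega), val_natCast_half] at this
  omega

/-- `(−(−(m)))).val = m` for `m ≤ 2n+1`. [folklore] -/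
theorem val_neg_neg_natCast {m : ℕ} (hm : m ≤ 2 * n + 1) :
    (-(-((m : ℕ) : ZMod (2 * n + 2)))).val = m := by
  rw [neg_neg, val_natCast_of_le hm]

/-- Links read by the positive-side exponent of the bond reflection are in the positive block:
non-`i` links based in the half `A`. [folklore] -/
theorem mem_bondPos_of_ne {i : Fin d} {s : Site d L₀ (2 * n + 2)} {μ : Dir d} (hμ : μ ≠ some i)
    (hs : (-s.2 i).val ≤ n) : (s, μ) ∈ bondPos d L₀ n i := by
  rw [mem_bondPos]
  exact ⟨hs, fun h => hμ h.1⟩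

/-- Direction-`i` links based at the slices `−1, …, −n` are in the positive block. [folklore] -/
theorem mem_bondPos_same {i : Fin d} {s : Site d L₀ (2 * n + 2)} {k : ℕ} (hk : k < n)
    (hs : s.2 i = -((k + 1 : ℕ) : ZMod (2 * n + 2))) : (s, some i) ∈ bondPos d L₀ n i := by
  rw [mem_bondPos, hs, val_neg_neg_natCast (by omega)]
  refine ⟨by omega, ?_⟩
  rintro ⟨-, h | h⟩
  · exact neg_natCast_succ_ne_zero hk.le h
  · exact neg_natCast_succ_ne_half hk h

/-- **The positive-side exponent of the bond reflection depends only on the positive block.** [folklore] -/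
theorem dependsOn_bondPosExp' (JE JM : ℝ) (i : Fin d) :
    DependsOn (bondPosExp ρ JE JM i : Config d L₀ (2 * n + 2) G → ℝ)
      ((bondPos d L₀ n i : Finset _) : Set _) := by
  intro U V hUV
  have hP : ∀ e ∈ bondPos d L₀ n i, U e = V e := fun e he => hUV e (Finset.mem_coe.2 he)
  simp only [bondPosExp]
  congr 1
  · exact inSlice_congr ρ JE JM i 0 fun s μ hs hμ => hP _ (mem_bondPos_of_ne hμ (by rw [hs]; simp))
  · refine Finset.sum_congr rfl fun k hk => ?_
    have hk' : k < n := Finset.mem_range.1 hk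
    congr 1
    · exact inSlice_congr ρ JE JM i _ fun s μ hs hμ => hP _ (mem_bondPos_of_ne hμ
        (by rw [hs, val_neg_neg_natCast (by omega)]; omega))
    · refine crossSlice_congr ρ JE JM i _ (fun s hs => hP _ (mem_bondPos_same hk' hs)) ?_
      intro s μ hs hμ
      refine hP _ (mem_bondPos_of_ne hμ ?_)
      rcases hs with hs | hs
      · rw [hs, val_neg_neg_natCast (by omega)]; omega
      · rw [hs]
        have : (-(-((k + 1 : ℕ) : ZMod (2 * n + 2)) + 1)) = -(-((k : ℕ) : ZMod (2 * n + 2))) := by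
          push_cast; ring
        rw [this, val_neg_neg_natCast (by omega)]; omega

/-- The same on `P ∪ C` (the form consumed by the abstract reflection-positivity theorem). [folklore] -/
theorem dependsOn_bondPosExp (JE JM : ℝ) (i : Fin d) :
    DependsOn (bondPosExp ρ JE JM i : Config d L₀ (2 * n + 2) G → ℝ)
      ((bondPos d L₀ n i ∪ bondCross d L₀ n i : Finset _) : Set _) := fun _ _ hUV =>
  dependsOn_bondPosExp' ρ JE JM i fun e he =>
    hUV e (Finset.mem_coe.2 (Finset.mem_union_left _ (Finset.mem_coe.1 he)))

/-- **The dependency condition of the abstract theorem for the bond reflection**: the `P ∪ C`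
coordinates of `θU` depend only on the coordinates of `U` off `P`. [folklore] -/
theorem dependsOn_spaceReflect_apply {i : Fin d} {e : Site d L₀ (2 * n + 2) × Dir d}
    (he : e ∈ bondPos d L₀ n i ∪ bondCross d L₀ n i) :
    DependsOn (fun U : Config d L₀ (2 * n + 2) G => spaceReflect i U e)
      (((bondPos d L₀ n i)ᶜ : Finset _) : Set _) := by
  intro U V hUV
  dsimp only
  rcases e with ⟨⟨t, x⟩, μ⟩
  by_cases hμ : μ = some i
  · subst hμ
    rw [spaceReflect_same, spaceReflect_same]
    have hmem : (((t, siteRefl i x), some i) : Site d L₀ (2 * n + 2) × Dir d) ∈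
        ((bondPos d L₀ n i)ᶜ : Finset _) := by
      rw [Finset.mem_compl, mem_bondPos]
      dsimp only
      rw [siteRefl_apply_same, neg_neg]
      rintro ⟨h1, h2⟩
      rcases Finset.mem_union.1 he with hP | hC
      · rw [mem_bondPos] at hP
        dsimp only at hP
        have hx := eq_neg_natCast_val_neg (x i)
        set m := (-x i).val with hm
        have hm1 : m ≤ n := hP.1
        have hm0 : m ≠ 0 := by
          intro h0
          have : x i = 0 := by rw [hx, h0]; simp
          exact hP.2 ⟨rfl, Or.inl this⟩
        rw [hx, val_neg_natCast (by omega) (by omega)] at h1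
        omega
      · rw [mem_bondCross] at hC
        dsimp only at hC
        apply h2
        refine ⟨rfl, ?_⟩
        rcases hC.2 with h | h
        · left; rw [h, neg_zero]
        · right; rw [h, neg_half]
    rw [hUV _ hmem]
  · rw [spaceReflect_apply_of_ne i U (t, x) hμ, spaceReflect_apply_of_ne i V (t, x) hμ]
    have hP : (-x i).val ≤ n := by
      rcases Finset.mem_union.1 he with hP | hC
      · exact (mem_bondPos.1 hP).1
      · exact absurd (mem_bondCross.1 hC).1 hμ
    have hmem : (((t, bondRefl i x), μ) : Site d L₀ (2 * n + 2) × Dir d) ∈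
        ((bondPos d L₀ n i)ᶜ : Finset _) := by
      rw [Finset.mem_compl, mem_bondPos]
      dsimp only
      rw [bondRefl_apply_same]
      rintro ⟨h1, -⟩
      have hx := eq_neg_natCast_val_neg (x i)
      set m := (-x i).val with hm
      rw [hx] at h1
      have : (-(1 - -((m : ℕ) : ZMod (2 * n + 2)))) = -((m + 1 : ℕ) : ZMod (2 * n + 2)) := by
        push_cast; ring
      rw [this, val_neg_natCast (by omega) (by omega)] at h1
      omega
    rw [hUV _ hmem]

end Depends

section DependsSite

variable {d L₀ n : ℕ} [NeZero L₀] {G : Type*} [Group G] {N : ℕ}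
variable (ρ : G →* Matrix (Fin N) (Fin N) ℂ)

/-- Non-`i` links at the slices `−1, …, −n` are in the positive block of the site reflection. [folklore] -/
theorem mem_sitePos_of_val {i : Fin d} {s : Site d L₀ (2 * n + 2)} {μ : Dir d}
    (h1 : 1 ≤ (-s.2 i).val) (h2 : (-s.2 i).val ≤ n) : (s, μ) ∈ sitePos d L₀ n i := by
  rw [mem_sitePos]; exact Or.inl ⟨h1, h2⟩

/-- Non-`i` links in the two planes are shared. [folklore] -/
theorem mem_siteShared_of {i : Fin d} {s : Site d L₀ (2 * n + 2)} {μ : Dir d} (hμ : μ ≠ some i)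
    (hs : s.2 i = 0 ∨ s.2 i = ((n + 1 : ℕ) : ZMod (2 * n + 2))) : (s, μ) ∈ siteShared d L₀ n i := by
  rw [mem_siteShared]; exact ⟨hμ, hs⟩

/-- **The positive-side exponent of the site reflection depends only on `P' ∪ M`.** [folklore] -/
theorem dependsOn_sitePosExp (JE JM : ℝ) (i : Fin d) :
    DependsOn (sitePosExp ρ JE JM i : Config d L₀ (2 * n + 2) G → ℝ)
      ((sitePos d L₀ n i ∪ ∅ ∪ siteShared d L₀ n i : Finset _) : Set _) := by
  intro U V hUV
  have hP : ∀ e ∈ sitePos d L₀ n i, U e = V e := fun e he =>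
    hUV e (Finset.mem_coe.2 (by simp [he]))
  have hM : ∀ e ∈ siteShared d L₀ n i, U e = V e := fun e he =>
    hUV e (Finset.mem_coe.2 (by simp [he]))
  -- a non-`i` link based at the slice `−m`, `m ≤ n + 1`, is positive or shared
  have hlink : ∀ (s : Site d L₀ (2 * n + 2)) (μ : Dir d) (m : ℕ), m ≤ n + 1 → μ ≠ some i →
      s.2 i = -((m : ℕ) : ZMod (2 * n + 2)) → U (s, μ) = V (s, μ) := by
    intro s μ m hm hμ hs
    by_cases hm0 : m = 0
    · exact hM _ (mem_siteShared_of hμ (Or.inl (by rw [hs, hm0]; simp)))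
    by_cases hm1 : m = n + 1
    · exact hM _ (mem_siteShared_of hμ (Or.inr (by rw [hs, hm1, neg_half])))
    · exact hP _ (mem_sitePos_of_val (by rw [hs, val_neg_neg_natCast (by omega)]; omega)
        (by rw [hs, val_neg_neg_natCast (by omega)]; omega))
  simp only [sitePosExp]
  congr 1
  · refine Finset.sum_congr rfl fun k hk => ?_
    have hk' : k < n := Finset.mem_range.1 hk
    exact inSlice_congr ρ JE JM i _ fun s μ hs hμ => hlink s μ (k + 1) (by omega) hμ hs
  · refine Finset.sum_congr rfl fun k hk => ?_
    have hk' : k < n + 1 := Finset.mem_range.1 hk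
    refine crossSlice_congr ρ JE JM i _ (fun s hs => hP _ ?_) ?_
    · rw [mem_sitePos]
      by_cases hkn : k = n
      · right; exact ⟨rfl, by rw [hs, hkn, neg_half]⟩
      · left
        rw [hs, val_neg_neg_natCast (by omega)]
        omega
    · intro s μ hs hμ
      rcases hs with hs | hs
      · exact hlink s μ (k + 1) (by omega) hμ hs
      · refine hlink s μ k (by omega) hμ ?_
        rw [hs]; push_cast; ring

/-- The plane terms depend only on the shared block. [folklore] -/
theorem dependsOn_inSlice_plane (JE JM : ℝ) (i : Fin d) {j : ZMod (2 * n + 2)}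
    (hj : j = 0 ∨ j = ((n + 1 : ℕ) : ZMod (2 * n + 2))) :
    DependsOn (inSlice ρ JE JM i j : Config d L₀ (2 * n + 2) G → ℝ)
      ((sitePos d L₀ n i ∪ ∅ ∪ siteShared d L₀ n i : Finset _) : Set _) := by
  intro U V hUV
  exact inSlice_congr ρ JE JM i j fun s μ hs hμ => hUV _ (Finset.mem_coe.2 (by
    simp only [Finset.union_empty, Finset.mem_union]
    exact Or.inr (mem_siteShared_of hμ (by rw [hs]; exact hj))))

omit [NeZero L₀] in
/-- **The site reflection fixes the shared block.** [folklore] -/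
theorem spaceSiteReflect_apply_of_mem_siteShared [NeZero L₀] {i : Fin d} (U : Config d L₀ (2 * n + 2) G)
    {e : Site d L₀ (2 * n + 2) × Dir d} (he : e ∈ siteShared d L₀ n i) : spaceSiteReflect i U e = U e := by
  rcases e with ⟨⟨t, x⟩, μ⟩
  rw [mem_siteShared] at he
  dsimp only at he
  have hμ : μ ≠ some i := he.1
  have hx : siteRefl i x = x := by
    funext j
    by_cases hj : j = i
    · subst hj
      rw [siteRefl_apply_same]
      rcases he.2 with h | h
      · rw [h, neg_zero]
      · rw [h, neg_half]
    · rw [siteRefl_apply_of_ne hj]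
  rcases μ with _ | k
  · rw [spaceSiteReflect_none, hx]
  · have hk : k ≠ i := fun h => hμ (by rw [h])
    rw [spaceSiteReflect_some_of_ne hk, hx]

/-- The plane terms are invariant under the site reflection. [folklore] -/
theorem inSlice_plane_spaceSiteReflect (JE JM : ℝ) (i : Fin d) {j : ZMod (2 * n + 2)}
    (hj : j = 0 ∨ j = ((n + 1 : ℕ) : ZMod (2 * n + 2))) (U : Config d L₀ (2 * n + 2) G) :
    inSlice ρ JE JM i j (spaceSiteReflect i U) = inSlice ρ JE JM i j U := by
  rw [inSlice_spaceSiteReflect]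
  rcases hj with rfl | rfl
  · rw [neg_zero]
  · rw [neg_half]

/-- **The dependency condition of the abstract theorem for the site reflection** (`1 ≤ n`): the `P'`
coordinates of `σU` depend only on the coordinates of `U` off `P'`. [folklore] -/
theorem dependsOn_spaceSiteReflect_apply (hn : 1 ≤ n) {i : Fin d} {e : Site d L₀ (2 * n + 2) × Dir d}
    (he : e ∈ sitePos d L₀ n i ∪ (∅ : Finset _)) :
    DependsOn (fun U : Config d L₀ (2 * n + 2) G => spaceSiteReflect i U e)
      (((sitePos d L₀ n i)ᶜ : Finset _) : Set _) := by
  intro U V hUV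
  dsimp only
  rw [Finset.union_empty] at he
  rcases e with ⟨⟨t, x⟩, μ⟩
  rw [mem_sitePos] at he
  dsimp only at he
  by_cases hμ : μ = some i
  · subst hμ
    rw [spaceSiteReflect_same, spaceSiteReflect_same]
    have hmem : (((t, siteRefl i x - Pi.single i 1), some i) : Site d L₀ (2 * n + 2) × Dir d) ∈
        ((sitePos d L₀ n i)ᶜ : Finset _) := by
      rw [Finset.mem_compl, mem_sitePos]
      dsimp only
      simp only [Pi.sub_apply, siteRefl_apply_same, Pi.single_eq_same]
      have hx := eq_neg_natCast_val_neg (x i)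
      set m := (-x i).val with hm
      rcases he with ⟨h1, h2⟩ | ⟨-, h⟩
      · -- `x i = −m`, `1 ≤ m ≤ n`; the reflected link sits at `m − 1 ∈ {0, …, n−1}`
        rw [hx]
        have hc : (-(-((m : ℕ) : ZMod (2 * n + 2))) - 1) = ((m - 1 : ℕ) : ZMod (2 * n + 2)) := by
          rw [neg_neg, Nat.cast_sub h1]; push_cast; ring
        rw [hc]
        rintro (⟨h3, h4⟩ | ⟨-, h5⟩)
        · by_cases hm1 : m = 1
          · rw [hm1] at h3; simp at h3
          · rw [val_neg_natCast (by omega) (by omega)] at h4; omega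
        · have := congrArg ZMod.val h5
          rw [val_natCast_half, val_natCast_of_le (by omega)] at this
          omega
      · -- `x i = n + 1`; the reflected link sits at `n`
        rw [h, neg_half]
        have hc : ((((n + 1 : ℕ) : ZMod (2 * n + 2))) - 1) = ((n : ℕ) : ZMod (2 * n + 2)) := by
          push_cast; ring
        rw [hc]
        rintro (⟨-, h4⟩ | ⟨-, h5⟩)
        · rw [val_neg_natCast hn (by omega)] at h4; omega
        · have := congrArg ZMod.val h5
          rw [val_natCast_half, val_natCast_of_le (by omega)] at this
          omega
    rw [hUV _ hmem]
  · have he' : 1 ≤ (-x i).val ∧ (-x i).val ≤ n := by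
      rcases he with h | ⟨h, -⟩
      · exact h
      · exact absurd h hμ
    have hval : ∀ U' : Config d L₀ (2 * n + 2) G, spaceSiteReflect i U' ((t, x), μ) = U' ((t, siteRefl i x), μ) := by
      intro U'
      rcases μ with _ | k
      · exact spaceSiteReflect_none i U' t x
      · have hk : k ≠ i := fun h => hμ (by rw [h])
        exact spaceSiteReflect_some_of_ne hk U' t x
    rw [hval U, hval V]
    have hmem : (((t, siteRefl i x), μ) : Site d L₀ (2 * n + 2) × Dir d) ∈
        ((sitePos d L₀ n i)ᶜ : Finset _) := by
      rw [Finset.mem_compl, mem_sitePos]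
      dsimp only
      rw [siteRefl_apply_same, neg_neg]
      have hx := eq_neg_natCast_val_neg (x i)
      set m := (-x i).val with hm
      rintro (⟨-, h4⟩ | ⟨h5, -⟩)
      · rw [hx, val_neg_natCast he'.1 (by omega)] at h4; omega
      · exact hμ h5
    rw [hUV _ hmem]

end DependsSite

end FiniteTemperature

end Literature.Barriers.QuantumFields

end
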